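import Summits.Ventures.YMGap.RobustBall.EnergyConcentrationDLR
import Summits.Ventures.YMGap.RobustBall.HeatBathConcentrationDLRBall
import HarnessLib

/-!
# Robust ball (Y2) — SELF-AVERAGING OF THE PLAQUETTE DENSITY IN EVERY GIBBS STATE OF EVERY MEMBER OF THE `ℤ^d` BALL

HONEST FRAMING: venture file of the cell `pub-ymgap` (QuantumFields programme), track ROBUST-BALL, seat rb-p2 (g14); the BALL-UNIFORM twin of
`EnergyConcentrationDLR.lean`: the plaquette-average tools there, fed with the member cells of `HeatBathConcentrationDLRBall.lean`.  LATTICE statements at STRONG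
COUPLING for the DLR states `μ ∈ 𝒢(γ^W)` of the perturbed specifications `γ^W = perturbedYM χ_N (Nβ) W supp` of the MEMBERS of rb-p1's `ℤ^d` ball (continuous
own-link terms, support `supp` of range `R`, per-link loads `a`, `ℓ_s`, row `Λ`, column `Λc`); the observable is the WILSON plaquette average
`A_P = |P|⁻¹ ∑_{p∈P} (1/N) Re tr U_p` in the member's Gibbs state; ONE rate for the whole ball; nothing about `β → ∞`, the continuum or Clay.
* ★★★ `gibbs_plaquetteAverage_deviation_le_onBall` — column condition `6(d−1)|β|K e^{a}(1 + 2√N ℓ_s) + √N Λc ≤ c < 1`, row condition `… + √N Λ < 1`: for EVERY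
  member, EVERY DLR state `μ ∈ 𝒢(γ^W)`, EVERY non-empty finite plaquette set `P` and `r ≥ 0`: `μ{|A_P − E_μ A_P| ≥ r} ≤ 2e^{2/3} exp(−r √((1 − c)|P|/(32(d−1))))`;
* ★★ `su2_gibbs_plaquetteAverage_deviation_le_onBall_quarter` — `SU(2)`, `d ≥ 2`, quarter modulus (tree coupling `β_W/2`): `c = (3/2)(d−1)β_W e^{a}(1 + 2√2 ℓ_s) + √2 Λc`.
0 sorry, 0 definitions.  References: S. Aida, D. Stroock, Math. Res. Lett. 1 (1994) 75; C. Külske, CMP 239 (2003) 29.  Everything here is proved. [folklore]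
-/

noncomputable section

open MeasureTheory Function Real Finset ProbabilityTheory Filter Topology
open scoped NNReal
open Summit.QuantumFields.YangMills.Theorems.StrongPinningPoincare
open Literature.Probability.LatticeModels Literature.Probability.LatticeModels.DobrushinMetric
open Literature.MathematicalPhysics.QuantumLattice hiding torusNorm
open Literature.MathematicalPhysics.QuantumFieldTheory hiding ZdEdge Site
open Literature.MathematicalPhysics.QuantumFieldTheory.Balaban1983to89.StrongCouplingDobrushinWindow (OneLinkKRModulus)

namespace Summit.Ventures.YMGap.RobustBall.HeatBathConcentration

variable {d N : ℕ}

/-- ★★★ **SELF-AVERAGING OF THE PLAQUETTE DENSITY IN EVERY GIBBS STATE OF EVERY MEMBER OF THE `ℤ^d` BALL** (`SU(N)`, 't Hooft `β`; member data as in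
`HeatBathPoincareZd.gibbsVariance_le_onBall`): for every DLR state `μ ∈ 𝒢(γ^W)`, every non-empty finite plaquette set `P` and `r ≥ 0`,
`μ{|A_P − E_μ A_P| ≥ r} ≤ 2e^{2/3} exp(−r √((1 − c)|P|/(32(d−1))))`. [folklore] -/
theorem gibbs_plaquetteAverage_deviation_le_onBall (hd : 2 ≤ d) (hN : 1 ≤ N) {β b K a ℓs Λ Λc R c : ℝ} (hK : 0 ≤ K) (hℓs : 0 ≤ ℓs)
    (hb : |β| * (2 * ((d : ℝ) - 1)) ≤ b) (hmod : OneLinkKRModulus N b K)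
    {W : Potential (ZdEdge d) (Matrix.specialUnitaryGroup (Fin N) ℂ)} (hWc : ∀ X, Continuous (W X))
    (hWdep : ∀ X, DependsOn (W X) (↑X : Set (ZdEdge d)))
    {supp : Finset (ZdEdge d) → Finset (Finset (ZdEdge d))} (hsupp : W.IsSupportedBy supp)
    {osc : Finset (ZdEdge d) → ZdEdge d → ℝ} (hosc : ∀ X, Dobrushin.IsOscBound (W X) (osc X))
    (hosca : ∀ e, ∑ X ∈ (supp {e}).filter (fun X => e ∈ X), osc X e ≤ a)
    {lip : Finset (ZdEdge d) → ZdEdge d → ℝ} (hlip : ∀ X, IsLipBound suFrobDist (W X) (lip X))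
    (hlips : ∀ e, ∑ X ∈ (supp {e}).filter (fun X => e ∈ X), lip X e ≤ ℓs)
    (hΛ : ∀ e, ∑ y ∈ perturbedNbr supp e, ∑ X ∈ (supp {e}).filter (fun X => e ∈ X), lip X y ≤ Λ)
    (hcol : ∀ (y : ZdEdge d) (T : Finset (ZdEdge d)), y ∉ T → ∑ e ∈ T, ∑ X ∈ (supp {e}).filter (fun X => e ∈ X), lip X y ≤ Λc)
    (hR : ∀ e, ∀ X ∈ supp {e}, e ∈ X → ∀ y ∈ X, ‖e.1 - y.1‖ ≤ R)
    (hc : 6 * ((d : ℝ) - 1) * |β| * (K * exp a * (1 + 2 * Real.sqrt N * ℓs)) + Real.sqrt N * Λc ≤ c) (hc1 : c < 1)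
    (hrow : 6 * ((d : ℝ) - 1) * |β| * (K * exp a * (1 + 2 * Real.sqrt N * ℓs)) + Real.sqrt N * Λ < 1)
    {μ : Measure (LGConfig d (Matrix.specialUnitaryGroup (Fin N) ℂ))}
    (hμ : μ ∈ perturbedGibbsMeasures (d := d) (fundamentalRep (Fin N)) (N * β) W supp)
    {P : Finset (ZdPlaquette d)} (hP : P.Nonempty) {r : ℝ} (hr : 0 ≤ r) :
    μ.real {U | r ≤ |(P.card : ℝ)⁻¹ * ∑ p ∈ P, zdPlaquetteObs (d := d) (fundamentalRep (Fin N)) p.1 p.2.1.1 p.2.1.2 U -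
        ∫ U', (P.card : ℝ)⁻¹ * ∑ p ∈ P, zdPlaquetteObs (d := d) (fundamentalRep (Fin N)) p.1 p.2.1.1 p.2.1.2 U' ∂μ|} ≤
      2 * (Real.exp (2 / 3) * Real.exp (-(r * Real.sqrt ((32 * ((d : ℝ) - 1) / ((1 - c) * P.card))⁻¹)))) := by
  classical
  haveI : SecondCountableTopology (Matrix (Fin N) (Fin N) ℂ) := inferInstanceAs (SecondCountableTopology (Fin N → Fin N → ℂ))
  haveI : SecondCountableTopology (Matrix.specialUnitaryGroup (Fin N) ℂ) := Topology.IsEmbedding.subtypeVal.secondCountableTopology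
  have hW : W.IsAdapted := fun X => ⟨hWdep X, (hWc X).measurable⟩
  have hWb : ∀ X, ∃ C, ∀ U, |W X U| ≤ C := fun X => exists_bound_of_continuous (hWc X)
  have hγ : IsSpecification (perturbedYM (d := d) (fundamentalRep (Fin N)) (N * β) W supp) :=
    isSpecification_perturbedYM _ (continuous_fundamentalRep (Fin N)) _ hW hWb hsupp
  have hμ' : IsGibbsMeasure (perturbedYM (d := d) (fundamentalRep (Fin N)) (N * β) W supp) μ := hμ
  haveI := hμ'.isProbabilityMeasure
  have hd1 : 1 ≤ d := by omega
  have hd0 : (0 : ℝ) < (d : ℝ) - 1 := by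
    have : (2 : ℝ) ≤ d := by exact_mod_cast hd
    linarith
  have hPpos : (0 : ℝ) < P.card := by exact_mod_cast hP.card_pos
  have hc0 : 0 < 1 - c := by linarith
  have hF := isLipschitzCylinder_plaquetteAverage (N := N) (d := d) P
  have hoscA : ∀ x ∈ P.biUnion plaquetteEdges, ∀ (U : LGConfig d (Matrix.specialUnitaryGroup (Fin N) ℂ)) (s : Matrix.specialUnitaryGroup (Fin N) ℂ),
      |(P.card : ℝ)⁻¹ * ∑ p ∈ P, zdPlaquetteObs (d := d) (fundamentalRep (Fin N)) p.1 p.2.1.1 p.2.1.2 U -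
        (P.card : ℝ)⁻¹ * ∑ p ∈ P, zdPlaquetteObs (d := d) (fundamentalRep (Fin N)) p.1 p.2.1.1 p.2.1.2 (update U x s)| ≤
        2 * ((P.filter fun p => x ∈ plaquetteEdges p).card : ℝ) / P.card := fun x _ U s => abs_plaquetteAverage_sub_update_le P x U s
  have hD := sum_sq_osc_plaquetteAverage_pos (d := d) hP
  have hup := gibbs_measureReal_deviation_ge_le_onBall hd1 hN hK hℓs hb hmod hWc hWdep hsupp hosc hosca hlip hlips hΛ hcol hR hc hc1 hrow hμ hF _ hoscA hD r
  have hdown := gibbs_measureReal_deviation_le_le_onBall hd1 hN hK hℓs hb hmod hWc hWdep hsupp hosc hosca hlip hlips hΛ hcol hR hc hc1 hrow hμ hF _ hoscA hD r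
  have hκpos : 0 < 2 * (2 * (1 - c))⁻¹ * ∑ x ∈ P.biUnion plaquetteEdges, (2 * ((P.filter fun p => x ∈ plaquetteEdges p).card : ℝ) / P.card) ^ 2 := by
    positivity
  have hκle : 2 * (2 * (1 - c))⁻¹ * ∑ x ∈ P.biUnion plaquetteEdges, (2 * ((P.filter fun p => x ∈ plaquetteEdges p).card : ℝ) / P.card) ^ 2 ≤
      32 * ((d : ℝ) - 1) / ((1 - c) * P.card) := by
    have h1 := sum_sq_osc_plaquetteAverage_le (d := d) hP
    calc _ = (1 - c)⁻¹ * ∑ x ∈ P.biUnion plaquetteEdges, (2 * ((P.filter fun p => x ∈ plaquetteEdges p).card : ℝ) / P.card) ^ 2 := by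
          field_simp
      _ ≤ (1 - c)⁻¹ * (32 * ((d : ℝ) - 1) / P.card) := mul_le_mul_of_nonneg_left h1 (inv_nonneg.2 hc0.le)
      _ = 32 * ((d : ℝ) - 1) / ((1 - c) * P.card) := by field_simp
  have hrate := exp_neg_div_sqrt_le hκpos hκle hr
  refine measureReal_abs_ge_le_of_tails μ (hup.trans ?_) (hdown.trans ?_) <;>
    exact mul_le_mul_of_nonneg_left hrate (Real.exp_pos _).le

/-- ★★ **`SU(2)`, `d ≥ 2`, QUARTER MODULUS** (tree coupling `β_W/2`; `(d−1)β_W/2 ≤ 1`; loads `(a, ℓ_s, Λ, Λc)`, range `R`;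
`c := (3/2)(d−1)β_W e^{a}(1 + 2√2 ℓ_s) + √2 Λc < 1`, `(3/2)(d−1)β_W e^{a}(1 + 2√2 ℓ_s) + √2 Λ < 1`): for every Gibbs state of every member, every non-empty
finite plaquette set `P` and `r ≥ 0`, `μ{|A_P − E_μ A_P| ≥ r} ≤ 2e^{2/3} exp(−r √((1 − c)|P|/(32(d−1))))`. [folklore] -/
theorem su2_gibbs_plaquetteAverage_deviation_le_onBall_quarter (hd : 2 ≤ d) {βW a ℓs Λ Λc R c : ℝ} (h0 : 0 ≤ βW)
    (hβ : ((d : ℝ) - 1) * βW / 2 ≤ 1) (hℓs : 0 ≤ ℓs) {W : Potential (ZdEdge d) (Matrix.specialUnitaryGroup (Fin 2) ℂ)}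
    (hWc : ∀ X, Continuous (W X)) (hWdep : ∀ X, DependsOn (W X) (↑X : Set (ZdEdge d)))
    {supp : Finset (ZdEdge d) → Finset (Finset (ZdEdge d))} (hsupp : W.IsSupportedBy supp)
    {osc : Finset (ZdEdge d) → ZdEdge d → ℝ} (hosc : ∀ X, Dobrushin.IsOscBound (W X) (osc X))
    (hosca : ∀ e, ∑ X ∈ (supp {e}).filter (fun X => e ∈ X), osc X e ≤ a)
    {lip : Finset (ZdEdge d) → ZdEdge d → ℝ} (hlip : ∀ X, IsLipBound suFrobDist (W X) (lip X))
    (hlips : ∀ e, ∑ X ∈ (supp {e}).filter (fun X => e ∈ X), lip X e ≤ ℓs)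
    (hΛ : ∀ e, ∑ y ∈ perturbedNbr supp e, ∑ X ∈ (supp {e}).filter (fun X => e ∈ X), lip X y ≤ Λ)
    (hcol : ∀ (y : ZdEdge d) (T : Finset (ZdEdge d)), y ∉ T → ∑ e ∈ T, ∑ X ∈ (supp {e}).filter (fun X => e ∈ X), lip X y ≤ Λc)
    (hR : ∀ e, ∀ X ∈ supp {e}, e ∈ X → ∀ y ∈ X, ‖e.1 - y.1‖ ≤ R)
    (hc : 3 / 2 * ((d : ℝ) - 1) * βW * (exp a * (1 + 2 * Real.sqrt 2 * ℓs)) + Real.sqrt 2 * Λc ≤ c) (hc1 : c < 1)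
    (hrow : 3 / 2 * ((d : ℝ) - 1) * βW * (exp a * (1 + 2 * Real.sqrt 2 * ℓs)) + Real.sqrt 2 * Λ < 1)
    {μ : Measure (LGConfig d (Matrix.specialUnitaryGroup (Fin 2) ℂ))}
    (hμ : μ ∈ perturbedGibbsMeasures (d := d) (fundamentalRep (Fin 2)) (βW / 2) W supp)
    {P : Finset (ZdPlaquette d)} (hP : P.Nonempty) {r : ℝ} (hr : 0 ≤ r) :
    μ.real {U | r ≤ |(P.card : ℝ)⁻¹ * ∑ p ∈ P, zdPlaquetteObs (d := d) (fundamentalRep (Fin 2)) p.1 p.2.1.1 p.2.1.2 U -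
        ∫ U', (P.card : ℝ)⁻¹ * ∑ p ∈ P, zdPlaquetteObs (d := d) (fundamentalRep (Fin 2)) p.1 p.2.1.1 p.2.1.2 U' ∂μ|} ≤
      2 * (Real.exp (2 / 3) * Real.exp (-(r * Real.sqrt ((32 * ((d : ℝ) - 1) / ((1 - c) * P.card))⁻¹)))) := by
  have hdd : (0 : ℝ) ≤ (d : ℝ) - 1 := by
    have : (2 : ℝ) ≤ d := by exact_mod_cast hd
    linarith
  have habs : |βW / 4| = βW / 4 := abs_of_nonneg (by positivity)
  have hβ' : ((2 : ℕ) : ℝ) * (βW / 4) = βW / 2 := by push_cast; ring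
  have hμ4 : μ ∈ perturbedGibbsMeasures (d := d) (fundamentalRep (Fin 2)) ((2 : ℕ) * (βW / 4)) W supp := by rwa [hβ']
  exact gibbs_plaquetteAverage_deviation_le_onBall (N := 2) hd (by norm_num) (β := βW / 4) zero_le_one hℓs (b := ((d : ℝ) - 1) * βW / 2)
    (by rw [habs]; nlinarith) (SlabAreaLawDimensions.su2_oneLinkKRModulus_of_le_one hβ) hWc hWdep hsupp hosc hosca hlip hlips hΛ hcol hR
    (c := c) (by rw [habs]; push_cast; nlinarith [hc]) hc1 (by rw [habs]; push_cast; nlinarith [hrow]) hμ4 hP hr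

end Summit.Ventures.YMGap.RobustBall.HeatBathConcentration

end
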